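import Mathlib
import Summits.ValiantsHypothesis.ValiantsHypothesis.Theorems.RigidityForcesSymmetryRankRigidMinimalReprLaplaceTriangular

/-!
# The interleaved hybrid witness lemma, part 1: the permanent pattern and the two row constructions
# (crux `RankRigidMinimalRepr`, stmt-ValiantsHypothesis-18034; frontier rung `LaplaceOptimalFive`, stmt-24813)

The strongest form of the greedy dual-witness construction found by the exhaustive certificate search of p8 g10
(evidence note NOTE-p8g10-24813 on the item; `game.py` / `game3.py`): compared with `hybrid_witness`
(`…LaplaceHybridWitness.lean`) the BASIS positions may be INTERLEAVED with the general ones, and a basis position `r` may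
DESIGNATE one constraint vector `Nv t φ` of a later slot that is already determined at position `r` (a slice vector, or a
pair vector whose other slot(s) come before `r`): the basis column is then chosen in the support of that vector among the
remaining columns (if the vector vanishes there the constraint is void on the remaining columns), and the slot of `t`
gets ONE free condition (single credit per slot).  A basis slot may itself carry one constraint if it is credited.

* `permanent_eq_prod_of_interleaved` — rows processed in order; basis rows supported on their own pivot and EARLIER basis
  pivots; general rows vanishing on EARLIER general pivots; then `per = Π pivots`;
* `general_row` / `basis_row` — one new row of either kind (with the absorption of one credited constraint);
* the construction itself (`hybrid_witness2`) is in `…LaplaceHybridWitness2.lean`.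

By exhaustive search this certificate shape covers ALL maximal cheap profiles of `P₅` with `≥ 3` slices (123) and 228 of
the 350 with two slices (kill sides chosen per pair).  General `n`; no new definitions.  HONEST FRAMING: infrastructure
for the frontier rung `LaplaceOptimalFive` (stmt-24813), which stays OPEN; nothing here bears on `VP ≠ VNP`.
-/

set_option autoImplicit false

-- the mandated summit-side namespace repeats a component by design (single-problem summit)
set_option linter.dupNamespace false

namespace Summit.ValiantsHypothesis.ValiantsHypothesis.Theorems.RigidityForcesSymmetryRankRigidMinimalRepr

namespace LaplaceTriangular

open Finset Module

variable {n : ℕ}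

/-! ### §1 The permanent for the interleaved pattern -/

/-- **Interleaved triangular permanent.**  Slots ranked by an injective `pos`, pivots `τ`, a set `F` of basis slots.
A basis slot `f` is supported on its pivot and the pivots of EARLIER basis slots; a general slot `i` vanishes at the
pivots of EARLIER general slots.  Then `per (φ_i(c))_{c,i} = Π_i φ_i(τ i)`. -/
theorem permanent_eq_prod_of_interleaved (φ : Fin n → Fin n → ℂ) (τ : Equiv.Perm (Fin n)) (pos : Fin n → ℕ)
    (hpos : Function.Injective pos) (F : Finset (Fin n))
    (hF : ∀ f ∈ F, ∀ x, φ f x ≠ 0 → x = τ f ∨ ∃ f' ∈ F, pos f' < pos f ∧ x = τ f')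
    (hG : ∀ i i', i ∉ F → i' ∉ F → pos i' < pos i → φ i (τ i') = 0) :
    (Matrix.of fun c i => φ i c).permanent = ∏ i, φ i (τ i) := by
  classical
  unfold Matrix.permanent
  rw [sum_eq_single τ]
  · simp [Matrix.of_apply]
  · intro σ _ hστ
    simp only [Matrix.of_apply]
    set π : Equiv.Perm (Fin n) := σ.trans τ.symm with hπ
    have hτπ : ∀ i, τ (π i) = σ i := fun i => by simp [hπ]
    by_contra hprod
    have hall : ∀ i, φ i (σ i) ≠ 0 := fun i h => hprod (prod_eq_zero (mem_univ i) h)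
    -- stage 1: basis slots are fixed by `π` (induction on `pos`)
    have hbasis : ∀ k : ℕ, ∀ f ∈ F, pos f ≤ k → π f = f := by
      intro k
      induction k with
      | zero =>
        intro f hf hk
        rcases hF f hf (σ f) (hall f) with h | ⟨f', hf', hlt, -⟩
        · exact τ.injective ((hτπ f).trans h)
        · omega
      | succ k ih =>
        intro f hf hk
        rcases hF f hf (σ f) (hall f) with h | ⟨f', hf', hlt, h⟩
        · exact τ.injective ((hτπ f).trans h)
        · -- `σ f = τ f'` with `f'` an earlier basis slot, but `σ f' = τ f'` already: contradiction with injectivity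
          have hf'fix : π f' = f' := ih f' hf' (by omega)
          have : σ f' = τ f' := by rw [← hτπ f', hf'fix]
          have hff' : f = f' := σ.injective (h.trans this.symm)
          rw [hff'] at hlt; exact absurd hlt (lt_irrefl _)
    have hπF : ∀ f ∈ F, π f = f := fun f hf => hbasis (pos f) f hf le_rfl
    have hπne : ∀ i, i ∉ F → π i ∉ F := fun i hi h => hi (by
      have := hπF (π i) h
      rw [π.injective this] at h
      exact h)
    -- stage 2: the sum argument on all slots
    have hge : ∀ i ∈ (univ : Finset (Fin n)), pos i ≤ pos (π i) := by
      intro i _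
      by_cases hi : i ∈ F
      · rw [hπF i hi]
      · by_contra hlt
        push Not at hlt
        have := hG i (π i) hi (hπne i hi) hlt
        rw [hτπ] at this
        exact hall i this
    have hsum : ∑ i, pos (π i) = ∑ i, pos i := Equiv.sum_comp π pos
    have heq := (sum_eq_sum_iff_of_le hge).mp hsum.symm
    apply hστ
    ext i
    have h1 : i = π i := hpos (heq i (mem_univ i))
    have h2 := hτπ i
    rw [← h1] at h2
    exact congrArg Fin.val h2.symm
  · intro h; exact absurd (mem_univ τ) h

/-! ### §2 One new row: the general step and the basis step -/

/-- The GENERAL step.  `Used` = pivots so far, `B` = the (non-credited) charged constraint vectors, optionally a credited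
vector `β₀` with its free column `f₀ ∈ Used` and the promise «`β₀ f₀ ≠ 0` or `β₀` vanishes off `Used`».  If
`|B| + |Used| < n` there is a row `ψ` with a pivot `cj ∉ Used`, vanishing on `Used` except possibly at `f₀`, killing
every vector of `B` and the credited one. -/
theorem general_row (Used : Finset (Fin n)) (B : Finset (Fin n → ℂ)) (credited : Bool) (β₀ : Fin n → ℂ) (f₀ : Fin n)
    (hcard : B.card + Used.card < n) (hf₀ : credited = true → f₀ ∈ Used)
    (hprom : credited = true → (β₀ f₀ ≠ 0 ∨ ∀ x, x ∉ Used → β₀ x = 0)) :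
    ∃ (ψ : Fin n → ℂ) (cj : Fin n), cj ∉ Used ∧ ψ cj ≠ 0 ∧ (∀ x ∈ Used, x ≠ f₀ → ψ x = 0) ∧
      (credited = false → ∀ x ∈ Used, ψ x = 0) ∧
      (∀ β ∈ B, ∑ y, ψ y * β y = 0) ∧ (credited = true → ∑ y, ψ y * β₀ y = 0) := by
  classical
  -- absorb the credited vector into the others when possible
  let absorb : Prop := credited = true ∧ β₀ f₀ ≠ 0
  let adj : (Fin n → ℂ) → (Fin n → ℂ) := fun β => if absorb then β - (β f₀ / β₀ f₀) • β₀ else β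
  let T : Finset (Fin n → ℂ) := B.image adj ∪ Used.image (fun x => Pi.single x 1)
  have hT : T.card < n :=
    lt_of_le_of_lt ((card_union_le _ _).trans (Nat.add_le_add card_image_le card_image_le)) hcard
  obtain ⟨ψ', hψ0, hψ⟩ := exists_ne_zero_orthogonal T hT
  have hψU : ∀ x ∈ Used, ψ' x = 0 := by
    intro x hx
    have := hψ (Pi.single x 1) (by simp only [T, mem_union, mem_image]; exact Or.inr ⟨x, hx, rfl⟩)
    simpa [Pi.single_apply] using this
  have hψB : ∀ β ∈ B, ∑ y, ψ' y * adj β y = 0 := fun β hβ =>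
    hψ (adj β) (by simp only [T, mem_union, mem_image]; exact Or.inl ⟨β, hβ, rfl⟩)
  obtain ⟨cj, hcj⟩ : ∃ x, ψ' x ≠ 0 := by by_contra h; push Not at h; exact hψ0 (funext h)
  have hcjU : cj ∉ Used := fun h => hcj (hψU cj h)
  -- the absorbing coefficient
  set S : ℂ := ∑ y, ψ' y * β₀ y with hS
  let t : ℂ := if absorb then -(S / β₀ f₀) else 0
  refine ⟨ψ' + Pi.single f₀ t, cj, hcjU, ?_, ?_, ?_, ?_, ?_⟩
  · -- pivot
    by_cases h : absorb
    · have hf := hf₀ h.1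
      have : cj ≠ f₀ := fun e => hcjU (e ▸ hf)
      simpa [Pi.single_apply, this] using hcj
    · simpa [t, h] using hcj
  · intro x hx hxf
    simp [hxf, hψU x hx]
  · intro hc x hx
    have : ¬ absorb := fun h => by have h1 := h.1; rw [hc] at h1; exact Bool.false_ne_true h1
    simp [t, this, hψU x hx]
  · intro β hβ
    have h1 := hψB β hβ
    simp only [Pi.add_apply, add_mul, sum_add_distrib]
    rw [show (∑ y, (Pi.single f₀ t : Fin n → ℂ) y * β y) = t * β f₀ from by
      rw [Fintype.sum_eq_single f₀ (fun y hy => by simp [hy])]; simp]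
    by_cases h : absorb
    · simp only [adj, h, if_true] at h1
      simp only [Pi.sub_apply, Pi.smul_apply, smul_eq_mul, mul_sub, sum_sub_distrib] at h1
      have h2 : ∑ y, ψ' y * β y = (β f₀ / β₀ f₀) * S := by
        rw [hS, mul_sum]
        have : ∑ x, ψ' x * (β f₀ / β₀ f₀ * β₀ x) = ∑ x, β f₀ / β₀ f₀ * (ψ' x * β₀ x) :=
          sum_congr rfl fun x _ => by ring
        rw [← this]; exact (sub_eq_zero.mp h1)
      rw [h2]
      simp only [t, h, if_true]
      field_simp
      ring
    · simp only [adj, h, if_false] at h1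
      simp [t, h, h1]
  · intro hc
    simp only [Pi.add_apply, add_mul, sum_add_distrib]
    rw [show (∑ y, (Pi.single f₀ t : Fin n → ℂ) y * β₀ y) = t * β₀ f₀ from by
      rw [Fintype.sum_eq_single f₀ (fun y hy => by simp [hy])]; simp]
    by_cases hb : β₀ f₀ ≠ 0
    · have h : absorb := ⟨hc, hb⟩
      rw [← hS]
      simp only [t, h, if_true]
      field_simp
      ring
    · push Not at hb
      have hvan : ∀ x, x ∉ Used → β₀ x = 0 := by
        rcases hprom hc with h | h
        · exact absurd hb h
        · exact h
      have hS0 : ∑ y, ψ' y * β₀ y = 0 := by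
        refine sum_eq_zero fun y _ => ?_
        by_cases hy : y ∈ Used
        · rw [hψU y hy, zero_mul]
        · rw [hvan y hy, mul_zero]
      rw [hS0, hb]; simp

/-- The BASIS step.  With `|Used| < n`, optionally a credited vector `β₀` (free column `f₀ ∈ Used`, same promise) and
optionally a vector `β'` to designate: a row `ψ = e_{cj} + t e_{f₀}` with `cj ∉ Used`, killing `β₀`, and such that
«`β' cj ≠ 0` or `β'` vanishes off `Used ∪ {cj}`». -/
theorem basis_row (Used : Finset (Fin n)) (hU : Used.card < n) (credited : Bool) (β₀ : Fin n → ℂ) (f₀ : Fin n)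
    (hf₀ : credited = true → f₀ ∈ Used) (hprom : credited = true → (β₀ f₀ ≠ 0 ∨ ∀ x, x ∉ Used → β₀ x = 0))
    (β' : Fin n → ℂ) :
    ∃ (ψ : Fin n → ℂ) (cj : Fin n), cj ∉ Used ∧ ψ cj ≠ 0 ∧
      (∀ x, ψ x ≠ 0 → x = cj ∨ (credited = true ∧ x = f₀)) ∧
      (credited = true → ∑ y, ψ y * β₀ y = 0) ∧
      (β' cj ≠ 0 ∨ ∀ x, x ∉ Used → x ≠ cj → β' x = 0) := by
  classical
  -- a column outside `Used`, in the support of `β'` if possible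
  have hex : ∃ x, x ∉ Used := by
    by_contra h; push Not at h
    have : (univ : Finset (Fin n)) ⊆ Used := fun x _ => h x
    have := card_le_card this; simp at this; omega
  obtain ⟨cj, hcjU, hcjβ⟩ : ∃ x, x ∉ Used ∧ (β' x ≠ 0 ∨ ∀ y, y ∉ Used → β' y = 0) := by
    by_cases h : ∃ x, x ∉ Used ∧ β' x ≠ 0
    · obtain ⟨x, hx, hb⟩ := h; exact ⟨x, hx, Or.inl hb⟩
    · push Not at h
      obtain ⟨x, hx⟩ := hex
      exact ⟨x, hx, Or.inr h⟩
  let absorb : Prop := credited = true ∧ β₀ f₀ ≠ 0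
  let t : ℂ := if absorb then -(β₀ cj / β₀ f₀) else 0
  have hcjf : credited = true → cj ≠ f₀ := fun hc e => hcjU (e ▸ hf₀ hc)
  refine ⟨Pi.single cj 1 + Pi.single f₀ t, cj, hcjU, ?_, ?_, ?_, ?_⟩
  · by_cases h : absorb
    · simp [(hcjf h.1)]
    · simp [t, h]
  · intro x hx
    by_cases hxc : x = cj
    · exact Or.inl hxc
    · right
      by_cases h : absorb
      · refine ⟨h.1, ?_⟩
        by_contra hxf
        apply hx; simp [hxc, hxf]
      · exfalso; apply hx; simp [hxc, t, h]
  · intro hc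
    simp only [Pi.add_apply, add_mul, sum_add_distrib]
    rw [Fintype.sum_eq_single cj (fun y hy => by simp [hy]),
      Fintype.sum_eq_single f₀ (fun y hy => by simp [hy])]
    simp only [Pi.single_eq_same, one_mul]
    by_cases hb : β₀ f₀ ≠ 0
    · have h : absorb := ⟨hc, hb⟩
      simp only [t, h, if_true]
      field_simp
      ring
    · push Not at hb
      have hvan : ∀ x, x ∉ Used → β₀ x = 0 := by
        rcases hprom hc with h | h
        · exact absurd hb h
        · exact h
      have h : ¬ absorb := fun h => h.2 hb
      simp [t, h, hvan cj hcjU]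
  · rcases hcjβ with h | h
    · exact Or.inl h
    · exact Or.inr (fun x hx _ => h x hx)

end LaplaceTriangular

end Summit.ValiantsHypothesis.ValiantsHypothesis.Theorems.RigidityForcesSymmetryRankRigidMinimalRepr
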